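/-
COR-CM (cell pub-hodgecm2, stage 2 of the Hodge ladder) — Δ2 BRIDGE, X1 (J) pin, piece **(J2) «ALBANESE ON COMPONENTS»**, LAW (v′)
UNCONDITIONAL: the covering hypothesis `hcover` of `CorCM/D2Bridge/AlbaneseOnPieceJointEpi.lean` («every point of `(∇X)_ℂ` lies in some
`Y_c × Y_c`», Liu's «`(∇X)_{k'} ≃ ∇_{k'}X'`», [Liu2021] §2.1 proof of the Proposition l. 1199) is DISCHARGED for `X` smooth projective
over a field of characteristic zero, by Galois descent of `∇` (the tree's `Liu2021/NablaGaloisDescent`) over a finite Galois splitting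
field (`Liu2021/SplittingField`) and transport to `ℂ` along a `k`-embedding; hence `albDesc_comp_baseChange_ne_zero`: the family
`albDesc a (inj c) (𝒥 c)` detects every non-zero `k`-rational homomorphism out of `Alb_X` — the J3 ⇄ J2 interface (`hfaith`) of the
Δ2 bridge, from Def. 2.3 OVER `k`, with NO named fact.  Provisional fifth hand own-crow g92 (prover-pub-hodgecm-own-crow-g92-0) for the
SEAT ASK d2bridge-prove-5 (pub-hodgecm2 OPS-REQUESTS l. 377).  ONE auxiliary definition (`bcProj`, the projection `Z ⊗_k ℂ → Z ⊗_k L`)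
and theorems; Literature-only imports besides the (J2) files; no manifest path; nothing landed is edited or restated.
FRAMING: HC_CM is NOT proved; «Δ2 BRIDGE CLOSED» is NOT claimed.
-/
import Summits.HodgeConjecture.CorCM.D2Bridge.AlbaneseOnPieceJointEpi
import Literature.NumberTheory.Automorphic.Liu2021.AlbaneseBaseChangeProduct
import Literature.NumberTheory.Automorphic.Liu2021.SplittingField
import Literature.AlgebraicGeometry.Motives.BaseChangeProofs
import Literature.AlgebraicGeometry.Motives.FiberBaseChange
import HarnessLib

/-!
# Δ2 bridge, (J2) LAW (v′) unconditional: the pieces `Y_c × Y_c` cover `(∇X)_ℂ`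

[Liu2021] Y. Liu, arXiv:2102.11518 = Camb. J. Math. 9 (2021), §2.1: Def. 2.1 (1) (l. 1171–1174: `∇X` = the smallest open and closed
subscheme of `X × X` containing the diagonal), proof of the Proposition (l. 1194–1200: over a separable closure `k'`, `∇_{k'}X' = ∐ X_i × X_i`
for the split scheme `X' = ⊔ X_i`, and «as `(∇X)_{k'} ≃ ∇_{k'}X'`, the statement for `X` then follows by Galois descent»).

* §1 `exists_fst_snd_mem_range_of_isGalois` — over a finite Galois `L / k` with a coproduct decomposition `e_j : E_j ⟶ X_L` into
  geometrically irreducible pieces, every point of `(∇X)_L` has both projections in ONE piece `E_j`.  This is the descent step, assembled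
  from the tree's lemmas (`Nabla.exists_of_isClopen`, `Nabla.mapsTo_gal_range_incl_μ`, `GaloisDescent.preimage_image_fst_eq`,
  `Nabla.range_incl_μ_subset_range_map`, `GaloisDescent.range_bcFunctor_map_left`) plus the MINIMALITY of the given `∇X` (Def. 2.1 (1)).
* §2 `bcProj` — the projection `Z ⊗_k ℂ → Z ⊗_k L` along a `k`-embedding `L ↪ ℂ`, its naturality (`map_left_comp_bcProj`), its reading
  through the transitivity isomorphism (`iso_hom_left_comp_bcProj`, tree `baseChangeHomObjIsoOfComp`), and
  `isPreconnected_bcProj_preimage_range`: the preimage of a geometrically irreducible piece is preconnected (image of `E ⊗_L ℂ`).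
* §3 `exists_nablaLiftPiece_apply_eq` — THE COVER over `ℂ` (split over `L` by `exists_isGalois_isColimit_isSmoothProjective_algPoints`, embed
  `L ↪ ℂ` by `IsAlgClosed.lift`, project, use §1 and §2, then the clopen partition of `X ⊗ ℂ` by the `Y_c`), and
  **`albDesc_comp_baseChange_ne_zero`** — LAW (v′) with no hypothesis left: for `f : Alb_X → B` non-zero over `k`,
  `∃ c, albDesc a (inj c) (𝒥 c) ≫ f_ℂ ≠ 0`.

Everything is proved; axioms `propext`, `Classical.choice`, `Quot.sound`.  HC_CM is NOT proved.

## References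
* [Liu2021] Y. Liu, arXiv:2102.11518: §2.1 Def. 2.1 (1), the Proposition with proof, Def. 2.3 (l. 1171–1208); Thm. 4.18 (1) (l. 2239).
* [GortzWedhorn2020] U. Görtz, T. Wedhorn, *Algebraic Geometry I*, 2nd ed.: Prop. 4.16 and §(4.7) (transitivity of base change), Prop. 5.50
  (irreducibility under base change), Def. 14.84, Thm. 14.83 (Galois descent), Theorem 14.72 (1).
-/

set_option autoImplicit false

noncomputable section

open CategoryTheory CategoryTheory.Limits AlgebraicGeometry MonoidalCategory CartesianMonoidalCategory NumberField
open Literature.AlgebraicGeometry.Motives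
open Literature.AlgebraicGeometry.HodgeTheory
open Literature.NumberTheory.Automorphic.Liu2021.AppendixC
open scoped MonObj

namespace Summit.HodgeConjecture.CorCM.D2Bridge

open AbelianVariety (bcSpec bcFunctor)

variable {k : Type} [Field k] [Algebra k ℂ] {X : SchemeOver k} (a : Albanese X)

/-! ## The COVER: every point of `(∇X)_ℂ` lies in some `Y_c × Y_c` (Liu's «`(∇X)_{k'} ≃ ∇_{k'}X'`», l. 1199) -/

section Cover

/-- `g (f x) = h x` from `f ≫ g = h` (pointwise reading of a commuting triangle of schemes). [folklore] -/
theorem apply_apply_of_comp_eq' {A B C : Scheme} {f : A ⟶ B} {g : B ⟶ C} {h : A ⟶ C} (e : f ≫ g = h) (x : A) :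
    g (f x) = h x := by
  rw [← e, Scheme.Hom.comp_apply]

variable {κ : Type} {Yc : κ → SchemeOver ℂ} (injc : ∀ c, Yc c ⟶ (bcFunctor k ℂ).obj X)

omit [Algebra k ℂ] in
set_option backward.isDefEq.respectTransparency false in
/-- **Over a finite Galois splitting field, `(∇X)_L` lies over the pieces `E_j × E_j`.**  For a finite Galois `L / k` and a finite
colimit cofan `e_j : E_j ⟶ X_L` of geometrically irreducible `L`-schemes, every point `n` of `(∇X)_L` has both projections
`(pr₁)_L n`, `(pr₂)_L n ∈ X_L` in the SAME piece `E_j`.  PROOF (the descent step of [Liu2021] §2.1, proof of the Proposition,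
l. 1194–1200, with the tree's Galois-descent lemmas of `Liu2021/NablaGaloisDescent`): `U_L := ⋃_j E_j × E_j` is a clopen subset of
`X_L × X_L` containing the diagonal and contained in every clopen subscheme containing it (`range_tensorHom_subset_range_of_diag`), so it
carries a `∇(X_L)` (`Nabla.exists_of_isClopen`); its image `W'` in `(X × X)_L` is Galois-stable (`Nabla.mapsTo_gal_range_incl_μ`), hence the
preimage of its image `W₀ ⊆ X × X` (`GaloisDescent.preimage_image_fst_eq`), which is clopen, contains `ΔX` and is minimal
(`Nabla.range_incl_μ_subset_range_map`), so carries a `∇X =: N₀` (`Nabla.exists_of_isClopen`); by MINIMALITY of `a.nabla` (Def. 2.1 (1))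
`a.nabla ⊆ N₀`, hence `(a.nabla)_L ⊆ pr⁻¹(W₀) = W' = μ(U_L)`. [cite: Liu2021, §2.1 Def. 2.1 (1) (l. 1174) and proof of the Proposition (l. 1194–1200)]
[cite: GortzWedhorn2020, Def. 14.84 and Thm. 14.83] -/
theorem exists_fst_snd_mem_range_of_isGalois (L : Type) [Field L] [Algebra k L] [FiniteDimensional k L] [IsGalois k L]
    {ιE : Type} [Finite ιE] {E : ιE → SchemeOver L} (e : ∀ j, E j ⟶ (bcFunctor k L).obj X)
    [∀ j, GeometricallyIrreducible (E j).hom] (hcol : IsColimit (Cofan.mk ((bcFunctor k L).obj X) e))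
    (n : ↥((bcFunctor k L).obj a.nabla.N).left) :
    ∃ j, ((bcFunctor k L).map (a.nabla.incl ≫ fst X X)).left n ∈ Set.range ⇑(e j).left ∧
      ((bcFunctor k L).map (a.nabla.incl ≫ snd X X)).left n ∈ Set.range ⇑(e j).left := by
  classical
  -- the clopen `U_L := ⋃_j pr₁⁻¹(E_j) ∩ pr₂⁻¹(E_j)` of `X_L × X_L`
  have hRc : ∀ j, IsClopen (Set.range ⇑(e j).left) := fun j => isClopen_range_left_of_isColimit hcol j
  obtain ⟨U, hU⟩ : ∃ U : Set ↥((bcFunctor k L).obj X ⊗ (bcFunctor k L).obj X).left,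
      U = ⋃ j, ⇑(fst ((bcFunctor k L).obj X) ((bcFunctor k L).obj X)).left ⁻¹' Set.range ⇑(e j).left ∩
        ⇑(snd ((bcFunctor k L).obj X) ((bcFunctor k L).obj X)).left ⁻¹' Set.range ⇑(e j).left := ⟨_, rfl⟩
  have hUo : IsOpen U := hU ▸ isOpen_iUnion fun j =>
    ((hRc j).2.preimage (fst ((bcFunctor k L).obj X) ((bcFunctor k L).obj X)).left.continuous).inter
      ((hRc j).2.preimage (snd ((bcFunctor k L).obj X) ((bcFunctor k L).obj X)).left.continuous)
  have hUc : IsClosed U := hU ▸ isClosed_iUnion_of_finite fun j =>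
    ((hRc j).1.preimage (fst ((bcFunctor k L).obj X) ((bcFunctor k L).obj X)).left.continuous).inter
      ((hRc j).1.preimage (snd ((bcFunctor k L).obj X) ((bcFunctor k L).obj X)).left.continuous)
  have hUj : ∀ j, Set.range ⇑(e j ⊗ₘ e j).left = ⇑(fst ((bcFunctor k L).obj X) ((bcFunctor k L).obj X)).left ⁻¹' Set.range ⇑(e j).left ∩
      ⇑(snd ((bcFunctor k L).obj X) ((bcFunctor k L).obj X)).left ⁻¹' Set.range ⇑(e j).left :=
    fun j => range_tensorHom_left_eq _ _
  -- the diagonal lies in `U_L`, and `U_L` is minimal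
  have hΔU : Set.range ⇑(lift (𝟙 ((bcFunctor k L).obj X)) (𝟙 ((bcFunctor k L).obj X))).left ⊆ U := by
    rw [hU]
    rintro _ ⟨x, rfl⟩
    obtain ⟨j, y, hy⟩ := exists_eq_left_of_isColimit hcol x
    refine Set.mem_iUnion.mpr ⟨j, ?_, ?_⟩
    · show (fst ((bcFunctor k L).obj X) ((bcFunctor k L).obj X)).left ((lift (𝟙 ((bcFunctor k L).obj X)) (𝟙 ((bcFunctor k L).obj X))).left x) ∈ Set.range ⇑(e j).left
      rw [← Scheme.Hom.comp_apply, ← Over.comp_left, lift_fst]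
      exact ⟨y, hy⟩
    · show (snd ((bcFunctor k L).obj X) ((bcFunctor k L).obj X)).left ((lift (𝟙 ((bcFunctor k L).obj X)) (𝟙 ((bcFunctor k L).obj X))).left x) ∈ Set.range ⇑(e j).left
      rw [← Scheme.Hom.comp_apply, ← Over.comp_left, lift_snd]
      exact ⟨y, hy⟩
  have hUmin : ∀ (W : SchemeOver L) (j : W ⟶ (bcFunctor k L).obj X ⊗ (bcFunctor k L).obj X), IsOpenImmersion j.left → IsClosedImmersion j.left →
      (∃ δ : (bcFunctor k L).obj X ⟶ W, δ ≫ j = lift (𝟙 ((bcFunctor k L).obj X)) (𝟙 ((bcFunctor k L).obj X))) → U ⊆ Set.range ⇑j.left := by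
    rintro W j hjo hjc ⟨δ, hδ⟩ z hz
    rw [hU] at hz
    obtain ⟨i, hi⟩ := Set.mem_iUnion.mp hz
    rw [← hUj] at hi
    haveI := hjo
    haveI := hjc
    exact range_tensorHom_subset_range_of_diag (Y := E) (inj := e) j hδ i hi
  obtain ⟨N', hN'⟩ := Nabla.exists_of_isClopen ((bcFunctor k L).obj X) U ⟨hUc, hUo⟩ hΔU hUmin
  -- its image `W'` in `(X × X)_L` is Galois-stable, so is the preimage of its image `W₀`
  haveI : IsOpenImmersion N'.incl.left := N'.isOpenImmersion_incl
  haveI : IsClosedImmersion N'.incl.left := N'.isClosedImmersion_incl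
  haveI : IsIso (Functor.LaxMonoidal.μ (bcFunctor k L) X X).left :=
    ((Over.forget _).mapIso (Functor.Monoidal.μIso (bcFunctor k L) X X)).isIso_hom
  haveI : IsOpenImmersion (N'.incl ≫ Functor.LaxMonoidal.μ (bcFunctor k L) X X).left := by
    rw [Over.comp_left]; infer_instance
  haveI : IsClosedImmersion (N'.incl ≫ Functor.LaxMonoidal.μ (bcFunctor k L) X X).left := by
    rw [Over.comp_left]; infer_instance
  haveI : IsFinite (bcSpec k L) :=
    (IsFinite.SpecMap_iff _).mpr (RingHom.finite_algebraMap.mpr inferInstance)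
  haveI : IsFinite (pullback.fst (X ⊗ X).hom (bcSpec k L)) := MorphismProperty.pullback_fst _ _ inferInstance
  have hclosed : IsClosedMap ⇑(pullback.fst (X ⊗ X).hom (bcSpec k L)) := (pullback.fst (X ⊗ X).hom (bcSpec k L)).isClosedMap
  have hsurj : Function.Surjective ⇑(pullback.fst (X ⊗ X).hom (bcSpec k L)) := (pullback.fst (X ⊗ X).hom (bcSpec k L)).surjective
  obtain ⟨W', hW'⟩ : ∃ W' : Set ↥(GaloisDescent.bc L (X ⊗ X)),
      W' = Set.range ⇑(N'.incl ≫ Functor.LaxMonoidal.μ (bcFunctor k L) X X).left := ⟨_, rfl⟩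
  have hW'o : IsOpen W' := hW' ▸ IsOpenImmersion.isOpen_range _
  have hW'c : IsClosed W' := hW' ▸ (Scheme.Hom.isClosedEmbedding _).isClosed_range
  have hstab : ∀ g : L ≃ₐ[k] L, Set.MapsTo ⇑(GaloisDescent.gal L (X ⊗ X) g) W' W' := fun g => by
    rw [hW']; exact N'.mapsTo_gal_range_incl_μ L g
  have hpre := GaloisDescent.preimage_image_fst_eq L (X ⊗ X) W' hstab
  obtain ⟨W₀, hW₀⟩ : ∃ W₀ : Set ↥(X ⊗ X).left, W₀ = ⇑(pullback.fst (X ⊗ X).hom (bcSpec k L)) '' W' := ⟨_, rfl⟩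
  have hW₀c : IsClosed W₀ := hW₀ ▸ hclosed _ hW'c
  have hcompl : W₀ᶜ = ⇑(pullback.fst (X ⊗ X).hom (bcSpec k L)) '' W'ᶜ := by
    ext z
    constructor
    · intro hz
      obtain ⟨y, rfl⟩ := hsurj z
      exact ⟨y, fun hy => hz (hW₀ ▸ ⟨y, hy, rfl⟩), rfl⟩
    · rintro ⟨y, hy, rfl⟩ hz
      apply hy
      rw [← hpre]
      rw [hW₀] at hz
      exact hz
  have hW₀o : IsOpen W₀ := by
    rw [← compl_compl W₀, hcompl, isOpen_compl_iff]
    exact hclosed _ hW'o.isClosed_compl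
  -- the diagonal of `X` lands in `W₀`
  have hdiagμ : N'.diag ≫ N'.incl ≫ Functor.LaxMonoidal.μ (bcFunctor k L) X X = (bcFunctor k L).map (lift (𝟙 X) (𝟙 X)) := by
    rw [← Category.assoc, N'.diag_incl, ← Functor.Monoidal.lift_μ, CategoryTheory.Functor.map_id]
  have hΔ : Set.range ⇑(lift (𝟙 X) (𝟙 X)).left ⊆ W₀ := by
    rintro _ ⟨x, rfl⟩
    obtain ⟨x', hx'⟩ := (pullback.fst X.hom (bcSpec k L)).surjective x
    rw [hW₀]
    refine ⟨((bcFunctor k L).map (lift (𝟙 X) (𝟙 X))).left x', ?_, ?_⟩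
    · rw [hW']
      exact ⟨N'.diag.left x', by rw [← Scheme.Hom.comp_apply, ← Over.comp_left, hdiagμ]⟩
    · rw [← hx']
      exact apply_apply_of_comp_eq' (GaloisDescent.bcFunctor_map_left_comp_fst L (lift (𝟙 X) (𝟙 X))) x'
  -- `W₀` is minimal, so carries a `∇X`
  have hmin : ∀ (W : SchemeOver k) (j : W ⟶ X ⊗ X), IsOpenImmersion j.left → IsClosedImmersion j.left →
      (∃ δ : X ⟶ W, δ ≫ j = lift (𝟙 X) (𝟙 X)) → W₀ ⊆ Set.range ⇑j.left := by
    rintro W j hjo hjc ⟨d, hd⟩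
    have h1 : W' ⊆ Set.range ⇑((bcFunctor k L).map j).left := by
      rw [hW']; exact N'.range_incl_μ_subset_range_map L j hjo hjc d hd
    rw [hW₀]
    rintro _ ⟨y, hy, rfl⟩
    obtain ⟨t, rfl⟩ := h1 hy
    exact ⟨pullback.fst W.hom (bcSpec k L) t,
      (apply_apply_of_comp_eq' (GaloisDescent.bcFunctor_map_left_comp_fst L j) t).symm⟩
  obtain ⟨N₀, hN₀⟩ := Nabla.exists_of_isClopen X W₀ ⟨hW₀c, hW₀o⟩ hΔ hmin
  -- MINIMALITY of `a.nabla`: `a.nabla ⊆ N₀`, hence `(a.nabla)_L ⊆ pr⁻¹(W₀) = W'`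
  obtain ⟨f, hf⟩ := a.nabla.minimal N₀.N N₀.incl N₀.isOpenImmersion_incl N₀.isClosedImmersion_incl ⟨N₀.diag, N₀.diag_incl⟩
  have hsub : Set.range ⇑a.nabla.incl.left ⊆ W₀ := by
    rw [← hN₀]
    rintro _ ⟨z, rfl⟩
    exact ⟨f.left z, by rw [← Scheme.Hom.comp_apply, ← Over.comp_left, hf]⟩
  have hsubL : Set.range ⇑((bcFunctor k L).map a.nabla.incl).left ⊆ W' := by
    rw [GaloisDescent.range_bcFunctor_map_left, ← hpre, ← hW₀]
    exact Set.preimage_mono hsub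
  -- read the point `n` through `W' = μ(U_L)`
  obtain ⟨n', hn'⟩ := (hW' ▸ hsubL) ⟨n, rfl⟩
  have hn'U : N'.incl.left n' ∈ U := hN' ▸ ⟨n', rfl⟩
  rw [hU] at hn'U
  obtain ⟨j, hj₁, hj₂⟩ := Set.mem_iUnion.mp hn'U
  refine ⟨j, ?_, ?_⟩
  · have h' : ((bcFunctor k L).map (a.nabla.incl ≫ fst X X)).left n =
        (fst ((bcFunctor k L).obj X) ((bcFunctor k L).obj X)).left (N'.incl.left n') := by
      rw [Functor.map_comp, Over.comp_left, Scheme.Hom.comp_apply, ← hn', ← Scheme.Hom.comp_apply, ← Over.comp_left,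
        Category.assoc, Functor.Monoidal.μ_fst, Over.comp_left, Scheme.Hom.comp_apply]
    rw [h']
    exact hj₁
  · have h' : ((bcFunctor k L).map (a.nabla.incl ≫ snd X X)).left n =
        (snd ((bcFunctor k L).obj X) ((bcFunctor k L).obj X)).left (N'.incl.left n') := by
      rw [Functor.map_comp, Over.comp_left, Scheme.Hom.comp_apply, ← hn', ← Scheme.Hom.comp_apply, ← Over.comp_left,
        Category.assoc, Functor.Monoidal.μ_snd, Over.comp_left, Scheme.Hom.comp_apply]
    rw [h']
    exact hj₂


/-! ### The projection `Z ⊗_k ℂ → Z ⊗_k L` along a `k`-embedding `L ↪ ℂ` -/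

section Proj

set_option backward.isDefEq.respectTransparency false

variable (L : Type) [Field L] [Algebra k L] [Algebra L ℂ]

/-- The projection `Z ⊗_k ℂ → Z ⊗_k L` of underlying schemes, for an `L`-algebra structure on `ℂ` compatible with `k`
(`Spec ℂ → Spec L → Spec k` = `Spec ℂ → Spec k`): the universal map of the fibre product (Görtz–Wedhorn I, Prop. 4.16).
[cite: GortzWedhorn2020, Prop. 4.16 and §(4.7)] -/
def bcProj (hS : bcSpec L ℂ ≫ bcSpec k L = bcSpec k ℂ) (Z : SchemeOver k) :
    ((bcFunctor k ℂ).obj Z).left ⟶ ((bcFunctor k L).obj Z).left :=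
  pullback.lift (pullback.fst Z.hom (bcSpec k ℂ)) (pullback.snd Z.hom (bcSpec k ℂ) ≫ bcSpec L ℂ)
    (by rw [Category.assoc, hS]; exact pullback.condition)

/-- `bcProj ≫ pr_Z = pr_Z`. [cite: GortzWedhorn2020, Prop. 4.16] -/
@[reassoc]
theorem bcProj_fst (hS : bcSpec L ℂ ≫ bcSpec k L = bcSpec k ℂ) (Z : SchemeOver k) : bcProj L hS Z ≫ pullback.fst Z.hom (bcSpec k L) = pullback.fst Z.hom (bcSpec k ℂ) :=
  pullback.lift_fst _ _ _

/-- `bcProj ≫ (Z ⊗ L → Spec L) = (Z ⊗ ℂ → Spec ℂ) ≫ (Spec ℂ → Spec L)`. [cite: GortzWedhorn2020, Prop. 4.16] -/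
@[reassoc]
theorem bcProj_snd (hS : bcSpec L ℂ ≫ bcSpec k L = bcSpec k ℂ) (Z : SchemeOver k) :
    bcProj L hS Z ≫ pullback.snd Z.hom (bcSpec k L) = pullback.snd Z.hom (bcSpec k ℂ) ≫ bcSpec L ℂ :=
  pullback.lift_snd _ _ _

/-- **Naturality of the projection** in the `k`-scheme: `g_ℂ ≫ bcProj = bcProj ≫ g_L`. [cite: GortzWedhorn2020, Prop. 4.16 and §(4.7)] -/
theorem map_left_comp_bcProj (hS : bcSpec L ℂ ≫ bcSpec k L = bcSpec k ℂ) {Z Z' : SchemeOver k} (g : Z ⟶ Z') :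
    ((bcFunctor k ℂ).map g).left ≫ bcProj L hS Z' = bcProj L hS Z ≫ ((bcFunctor k L).map g).left := by
  apply pullback.hom_ext
  · rw [Category.assoc, bcProj_fst, Category.assoc, GaloisDescent.bcFunctor_map_left_comp_fst,
      GaloisDescent.bcFunctor_map_left_comp_fst, bcProj_fst_assoc]
  · rw [Category.assoc, bcProj_snd, Category.assoc]
    have h1 : ((bcFunctor k ℂ).map g).left ≫ pullback.snd Z'.hom (bcSpec k ℂ) = pullback.snd Z.hom (bcSpec k ℂ) :=
      Over.w ((bcFunctor k ℂ).map g)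
    have h2 : ((bcFunctor k L).map g).left ≫ pullback.snd Z'.hom (bcSpec k L) = pullback.snd Z.hom (bcSpec k L) :=
      Over.w ((bcFunctor k L).map g)
    rw [reassoc_of% h1, h2, bcProj_snd]

/-- The projection read through the transitivity isomorphism `(Z ⊗_k L) ⊗_L ℂ ≅ Z ⊗_k ℂ` is the first projection of
`(Z ⊗_k L) ⊗_L ℂ`. [cite: GortzWedhorn2020, Prop. 4.16 and §(4.7)] -/
theorem iso_hom_left_comp_bcProj (hS : bcSpec L ℂ ≫ bcSpec k L = bcSpec k ℂ) (hτ : (algebraMap L ℂ).comp (algebraMap k L) = algebraMap k ℂ) (Z : SchemeOver k) :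
    (baseChangeHomObjIsoOfComp (algebraMap k L) (algebraMap L ℂ) (algebraMap k ℂ) hτ Z).hom.left ≫ bcProj L hS Z =
      pullback.fst ((bcFunctor k L).obj Z).hom (bcSpec L ℂ) := by
  apply pullback.hom_ext
  · rw [Category.assoc, bcProj_fst]
    exact baseChangeHomObjIsoOfComp_hom_left_fst (algebraMap k L) (algebraMap L ℂ) (algebraMap k ℂ) hτ Z
  · rw [Category.assoc, bcProj_snd]
    have h1 : (baseChangeHomObjIsoOfComp (algebraMap k L) (algebraMap L ℂ) (algebraMap k ℂ) hτ Z).hom.left ≫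
        pullback.snd Z.hom (bcSpec k ℂ) = pullback.snd ((bcFunctor k L).obj Z).hom (bcSpec L ℂ) :=
      Over.w (baseChangeHomObjIsoOfComp (algebraMap k L) (algebraMap L ℂ) (algebraMap k ℂ) hτ Z).hom
    rw [reassoc_of% h1]
    exact pullback.condition.symm

set_option maxHeartbeats 400000 in
/-- **The preimage of a geometrically irreducible piece `E ⊆ Z ⊗_k L` under the projection `Z ⊗_k ℂ → Z ⊗_k L` is preconnected**:
it is the image of the irreducible `E ⊗_L ℂ` (geometric irreducibility is stable under base change, `IsSmoothProjective.baseChange_obj`)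
under `e_ℂ` followed by the transitivity isomorphism. [cite: GortzWedhorn2020, Prop. 4.16 and Prop. 5.50] -/
theorem isPreconnected_bcProj_preimage_range (hS : bcSpec L ℂ ≫ bcSpec k L = bcSpec k ℂ) (hτ : (algebraMap L ℂ).comp (algebraMap k L) = algebraMap k ℂ) (Z : SchemeOver k)
    {d : ℕ} {E : SchemeOver L} (hE : IsSmoothProjective d E) (e : E ⟶ (bcFunctor k L).obj Z) :
    _root_.IsPreconnected (⇑(bcProj L hS Z) ⁻¹' Set.range ⇑e.left) := by
  let iso : (bcFunctor L ℂ).obj ((bcFunctor k L).obj Z) ≅ (bcFunctor k ℂ).obj Z :=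
    baseChangeHomObjIsoOfComp (algebraMap k L) (algebraMap L ℂ) (algebraMap k ℂ) hτ Z
  have hiso : iso.hom.left ≫ bcProj L hS Z = pullback.fst ((bcFunctor k L).obj Z).hom (bcSpec L ℂ) :=
    iso_hom_left_comp_bcProj L hS hτ Z
  haveI : GeometricallyIrreducible ((bcFunctor L ℂ).obj E).hom := (hE.baseChange_obj ℂ).geometricallyIrreducible
  haveI : IrreducibleSpace ↥((bcFunctor L ℂ).obj E).left :=
    GeometricallyIrreducible.irreducibleSpace_of_subsingleton ((bcFunctor L ℂ).obj E).hom
  haveI : IsIso iso.hom.left := ((Over.forget _).mapIso iso).isIso_hom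
  have hrange : ⇑(bcProj L hS Z) ⁻¹' Set.range ⇑e.left = Set.range ⇑(((bcFunctor L ℂ).map e).left ≫ iso.hom.left) := by
    ext x
    constructor
    · intro hx
      obtain ⟨y0, rfl⟩ := iso.hom.left.surjective x
      have hx' : (iso.hom.left ≫ bcProj L hS Z) y0 ∈ Set.range ⇑e.left := by
        rw [Scheme.Hom.comp_apply]; exact hx
      rw [hiso] at hx'
      have hy0 : y0 ∈ Set.range ⇑((bcFunctor L ℂ).map e).left := by
        rw [GaloisDescent.range_bcFunctor_map_left]
        exact hx'
      obtain ⟨y, hy⟩ := hy0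
      refine ⟨y, ?_⟩
      rw [Scheme.Hom.comp_apply, hy]
    · rintro ⟨y, rfl⟩
      have hcomp : (((bcFunctor L ℂ).map e).left ≫ iso.hom.left) ≫ bcProj L hS Z =
          ((bcFunctor L ℂ).map e).left ≫ pullback.fst ((bcFunctor k L).obj Z).hom (bcSpec L ℂ) := by
        rw [Category.assoc, hiso]
      rw [Set.mem_preimage, apply_apply_of_comp_eq' hcomp y]
      have h2 := apply_apply_of_comp_eq' (GaloisDescent.bcFunctor_map_left_comp_fst ℂ e) y
      exact ⟨pullback.fst E.hom (bcSpec L ℂ) y,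
        ((Scheme.Hom.comp_apply _ _ _).symm.trans h2.symm).trans (Scheme.Hom.comp_apply _ _ _).symm⟩
  rw [hrange]
  exact isPreconnected_range (Scheme.Hom.continuous _)

end Proj

set_option maxHeartbeats 400000 in
set_option backward.isDefEq.respectTransparency false in
/-- **THE COVER: every point of `(∇X)_ℂ` lies in some `Y_c × Y_c`** — the hypothesis `hcover` of
`albDesc_comp_baseChange_ne_zero_of_cover` HOLDS for `X` smooth projective over a field `k` of characteristic zero and any
coproduct decomposition `inj_c : Y_c ⟶ X ⊗_k ℂ` into geometrically irreducible pieces.  PROOF: split `X` over a finite Galois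
`L / k` (`exists_isGalois_isColimit_isSmoothProjective_algPoints`), where `(∇X)_L` lies over the pieces `E_j × E_j`
(`exists_fst_snd_mem_range_of_isGalois`); embed `L ↪ ℂ` over `k` (`IsAlgClosed.lift`) and project the two coordinates of a point of
`(∇X)_ℂ` to `X_L` (`bcProj`, natural): they lie in one `E_j`, whose preimage in `X ⊗ ℂ` is preconnected
(`isPreconnected_bcProj_preimage_range`), hence inside ONE piece `Y_c`; so both coordinates lie in `Y_c` and the point lifts to
`Y_c × Y_c`.  Liu's «`(∇X)_{k'} ≃ ∇_{k'}X'`» read over `ℂ`.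
[cite: Liu2021, §2.1 Def. 2.1 (1) (l. 1174) and proof of the Proposition (l. 1194–1200)] [cite: GortzWedhorn2020, Prop. 4.16 and §(4.7)] -/
theorem exists_nablaLiftPiece_apply_eq [CharZero k] {d : ℕ} [SmoothOfRelativeDimension d X.hom] (hX : IsProjectiveOver X)
    [∀ c, GeometricallyIrreducible (Yc c).hom] (hcol : IsColimit (Cofan.mk ((bcFunctor k ℂ).obj X) injc))
    (n : ↥((bcFunctor k ℂ).obj a.nabla.N).left) :
    ∃ (c : κ) (z : ↥(Yc c ⊗ Yc c).left), (nablaLiftPiece a (injc c)).left z = n := by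
  classical
  -- split `X` over a finite Galois extension `L / k`
  obtain ⟨L, _, _, _, _, C, _, E, e, hE, -, ⟨hcolL⟩⟩ :=
    exists_isGalois_isColimit_isSmoothProjective_algPoints (d := d) X hX
  haveI : ∀ j, GeometricallyIrreducible (E j).hom := fun j => (hE j).geometricallyIrreducible
  -- a `k`-embedding `τ : L → ℂ`
  set τ : L →ₐ[k] ℂ := IsAlgClosed.lift with hτdef
  letI : Algebra L ℂ := (τ : L →+* ℂ).toAlgebra
  have hτ : (algebraMap L ℂ).comp (algebraMap k L) = algebraMap k ℂ := τ.comp_algebraMap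
  have hS : bcSpec L ℂ ≫ bcSpec k L = bcSpec k ℂ := by
    change Spec.map _ ≫ Spec.map _ = Spec.map _
    rw [← Spec.map_comp, ← CommRingCat.ofHom_comp, hτ]
  -- over `L`, the two coordinates of the projected point lie in one piece `E_j`
  obtain ⟨j, hj₁, hj₂⟩ := exists_fst_snd_mem_range_of_isGalois a L e hcolL (bcProj L hS a.nabla.N n)
  have hx₁ : bcProj L hS X (((bcFunctor k ℂ).map (a.nabla.incl ≫ fst X X)).left n) ∈ Set.range ⇑(e j).left := by
    rw [← Scheme.Hom.comp_apply, map_left_comp_bcProj, Scheme.Hom.comp_apply]; exact hj₁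
  have hx₂ : bcProj L hS X (((bcFunctor k ℂ).map (a.nabla.incl ≫ snd X X)).left n) ∈ Set.range ⇑(e j).left := by
    rw [← Scheme.Hom.comp_apply, map_left_comp_bcProj, Scheme.Hom.comp_apply]; exact hj₂
  -- the piece `Y_c` of the first coordinate contains the preconnected preimage of `E_j`, hence the second coordinate
  have hT := isPreconnected_bcProj_preimage_range L hS hτ X (hE j) (e j)
  obtain ⟨c, y₁, hy₁⟩ := exists_eq_left_of_isColimit hcol (((bcFunctor k ℂ).map (a.nabla.incl ≫ fst X X)).left n)
  have hTc : ⇑(bcProj L hS X) ⁻¹' Set.range ⇑(e j).left ⊆ Set.range ⇑(injc c).left :=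
    hT.subset_isClopen (isClopen_range_left_of_isColimit hcol c) ⟨_, hx₁, y₁, hy₁⟩
  have h₁ : ((bcFunctor k ℂ).map (a.nabla.incl ≫ fst X X)).left n ∈ Set.range ⇑(injc c).left := ⟨y₁, hy₁⟩
  have h₂ : ((bcFunctor k ℂ).map (a.nabla.incl ≫ snd X X)).left n ∈ Set.range ⇑(injc c).left := hTc hx₂
  -- lift `n` to `Y_c × Y_c`
  have hδ : (Functor.OplaxMonoidal.δ (bcFunctor k ℂ) X X).left (((bcFunctor k ℂ).map a.nabla.incl).left n) ∈
      Set.range ⇑(injc c ⊗ₘ injc c).left := by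
    rw [range_tensorHom_left_eq]
    constructor
    · rw [Set.mem_preimage, ← Scheme.Hom.comp_apply, ← Scheme.Hom.comp_apply, ← Over.comp_left, ← Over.comp_left,
        Functor.OplaxMonoidal.δ_fst, ← Functor.map_comp]
      exact h₁
    · rw [Set.mem_preimage, ← Scheme.Hom.comp_apply, ← Scheme.Hom.comp_apply, ← Over.comp_left, ← Over.comp_left,
        Functor.OplaxMonoidal.δ_snd, ← Functor.map_comp]
      exact h₂
  obtain ⟨w, hw⟩ := hδ
  haveI := a.nabla.isOpenImmersion_incl
  haveI := GaloisDescent.isOpenImmersion_bcFunctor_map_left ℂ a.nabla.incl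
  refine ⟨c, w, ((bcFunctor k ℂ).map a.nabla.incl).left.isOpenEmbedding.injective ?_⟩
  rw [← Scheme.Hom.comp_apply, ← Over.comp_left, nablaLiftPiece_incl, Over.comp_left, Scheme.Hom.comp_apply, hw,
    ← Scheme.Hom.comp_apply, ← Over.comp_left, Functor.Monoidal.δ_μ]
  rfl

/-- **LAW (v′), UNCONDITIONAL: `α` on the pieces detects every non-zero `k`-rational homomorphism out of `Alb_X`** — for `X` smooth
projective over a field `k` of characteristic zero, an Albanese datum `a` (Def. 2.3), a coproduct decomposition `inj_c : Y_c ⟶ X ⊗ ℂ`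
into geometrically irreducible pieces with Albanese data `𝒥_c`, and `f : Alb_X → B` non-zero over `k`:
`∃ c, albDesc a (inj c) (𝒥 c) ≫ f_ℂ ≠ 0` (`albDesc_comp_baseChange_ne_zero_of_cover` + `exists_nablaLiftPiece_apply_eq`).  This is the
J3 ⇄ J2 interface of the Δ2 bridge (`hfaith`): with `f ∈ Hom_E(A_K, A_μ)` non-zero, some component map
`(α_K)_x|_{P_Γ} ≫ f_ℂ = f^x ≫ (albDesc ≫ f_ℂ)` is non-zero, hence non-zero on `H¹` (d2bridge-prove-3's `exists_pull_abelJacobi_comp_ne_zero`).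
[cite: Liu2021, §2.1 Def. 2.3 with the Proposition (l. 1190–1208), proof of Lemma 2.4 (1) (l. 1220–1228), Thm. 4.18 (1) (l. 2239)]
[cite: GortzWedhorn2020, Theorem 14.72 (1)] -/
theorem albDesc_comp_baseChange_ne_zero [CharZero k] {d : ℕ} [SmoothOfRelativeDimension d X.hom] (hX : IsProjectiveOver X)
    [∀ c, GeometricallyIrreducible (Yc c).hom] (hcol : IsColimit (Cofan.mk ((bcFunctor k ℂ).obj X) injc))
    (𝒥 : ∀ c, Jacobian (Yc c)) {B : AbelianVariety k} {f : a.Alb ⟶ B} (hf : f ≠ 0) :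
    ∃ c, albDesc a (injc c) (𝒥 c) ≫ AbelianVariety.Hom.baseChange ℂ f ≠ 0 :=
  albDesc_comp_baseChange_ne_zero_of_cover a injc hcol 𝒥 (exists_nablaLiftPiece_apply_eq (d := d) a injc hX hcol) hf

end Cover

end Summit.HodgeConjecture.CorCM.D2Bridge

end
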